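import Summits.ResolutionOfSingularities.ResolutionOfSingularities.Theorems.EquisingularLiftEquisingularLiftNatSectionRootTransport
import Summits.ResolutionOfSingularities.ResolutionOfSingularities.Theorems.EquisingularLiftEquisingularLiftNatSpecialFibreFrames
import Summits.ResolutionOfSingularities.ResolutionOfSingularities.Theorems.EquisingularLiftEquisingularLiftNatDirectionCentreCartier
import Summits.ResolutionOfSingularities.ResolutionOfSingularities.Theorems.EquisingularLiftEquisingularLiftNatDirectionCentreComap
import Summits.ResolutionOfSingularities.ResolutionOfSingularities.Theorems.EquisingularLiftEquisingularLiftNatDirDictSection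
import Summits.ResolutionOfSingularities.ResolutionOfSingularities.Theorems.EquisingularLiftEquisingularLiftNatTowerCurveStep
import Summits.ResolutionOfSingularities.ResolutionOfSingularities.Theorems.EquisingularLiftEquisingularLiftNatTowerRationalDefs
import Literature.AlgebraicGeometry.Motives.ProjectiveSpaceLinearSubspaces
import Literature.AlgebraicGeometry.Resolution.BlowupDisjointCentreSplitting
import HarnessLib

/-!
# [OURS · L1 W4.5(b) · EL♮(3)] S6 (a)–(c) ASSEMBLED — THE CENTRE AT THE ROOT OF `DirLift.Ruled` FROM T-DIRLIFT-UP: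
# res-D-pv-057's root-level stand-in (N1°) `hRootCentre` (…NatTowerCechCentre p570977) ⇐ ONE named input `hUP` = T-DIRLIFT-UP in the
# currency the tower CAN supply (abstract exceptional pair; no ambient-regularity clause)

Crux chain w45b (cell `res-hironaka`, slot W4.5(b)), working crux **EL♮** = stmt-ResolutionOfSingularities-20038, child **EL♮(3)** =
stmt-ResolutionOfSingularities-20148, route EquisingularLift, line `sections`; rung TOWER₃/₄, stand-in S6 `hCech` = res-D-pv-057's
`Tower.hCech_of` (p569903) ⇐ (N1) `hCentre` ⇐ (N1°) `hRootCentre` (`Tower.hCentre_of_root`, p570977). Written by res-L1-w45b-stub-2 g7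
(STATUS 2026-08-27T21:35Z; INTERFACE FINDING 20:58:54Z, res-D-pv-051 WORD 21:06:46Z (hreg idle ⇒ dropped; abstract exceptional pair adopted in principle)). HONEST FRAMING: OURS; NOT a statement of any manuscript; AI-written, weaker than
expert review. No `sorry`; standard axioms. DEF-FREE. `--supports stmt-ResolutionOfSingularities-20148 --as helper`. Pattern (E): elaborates
with ONE named stand-in and shrinks when it lands.

WHAT. `Tower.hRootCentre_of_dirLiftUp`: the (N1°) text VERBATIM (∀ Čech-witnessed stage with its round data — `DirStepSec`, `RationalCarrier`,
regularity of `G`/`Ẽ` along `Z̃`, `DirStepUnobs`, `Z ⊆ E` —, its exceptional surface `𝓔` and the unpacked root of `DirLift.Ruled`: ∃ `C₁ ⊇ I·𝒪_{X₁}`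
on `X₁`, `V(C₁)` regular, `O`-flat, `C₁|_{V(I·𝒪_{X₁})}` effective Cartier, `C₁·𝒪_{G₁} = 𝓘⟨Γ₁⟩` with `E ∩ ϱ⁻¹Γ₁ = Z`, `V(C₁) ≅ ℙ¹_O` over `q`)
FOLLOWS from the single named input
* **`hUP` = T-DIRLIFT-UP** (res-D-pv-051's `exists_directionLift_of_unobstructed`, sig `L/res-D-pv-051/TARGET-DIRLIFT-UP.sig.lean`
  9b7825e935ffb8f7) **in the currency the tower supplies** (res-L1-w45b-stub-2 INTERFACE FINDING 20:58:54Z, variant «v3»): (i) the frames of the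
  conclusion at EVERY point of `supp I` (plan-1 20:09:14Z); (ii) the exceptional pair ABSTRACT — `ιE : Ẽ ⟶ G₁`, `ιΓ : Γ̃ ⟶ Ẽ` closed
  immersions of reduced schemes with `range ιE = υ⁻¹Z`, and `hsec`/`hEreg`/`hunobs`/`hctr` about `(Γ̃, ιΓ, ιE)` (the tower feeds the STAGE pair
  `redSub G Z ⟶ redSub G E ⟶(ε) redSub G₁ (υ₁⁻¹Z₀) ⟶ G₁` along the special-fibre bridge `ε`, so NO normal-sheaf transport is needed); (iii) NO
  ambient clause «`G₁` regular along `Γ`» (not suppliable from the stage: finding (1)) and no `hri` (derivable from `hfr` + regularity).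
Everything else is in the tree: the bridge and the pushed section (…NatSectionRootTransport p570399), the descended frames (…NatSpecialFibreFrames
p571252), DIRDICT (a) `exists_direction_of_section` (res-D-pv-051, p559974), T-DIRLIFT D3b `exists_subschemeIso_directionCentre` (p555056), D4
`comap_directionCentre_eq_of_model` (p551347), D5 `isEffectiveCartier_directionCentre_comap_exceptional` (p569018), `comap_le_directionCentre`,
res-D-pv-029's `isPullback_of_model_squares`; `C₁ := controlledTransform τ₀ I 𝒟 1` for the lifted direction `𝒟`, `Γ₁ := ϱ '' Z`.
⇒ with res-D-pv-057's p570977 / p569903: **S6 `hCech`'s (N1) = CLOSED MODULO {T-DIRLIFT-UP (v3 currency)}** (the (N3)/(N3′) shadow stand-ins are separate).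

References (index only): [cite: GortzWedhorn2020, Prop. 4.20 and (13.19)] [cite: StacksProject, Tags 0804, 0805, 01WS] [cite: Hartshorne1977, II Example 3.2.6].
-/

set_option linter.dupNamespace false -- mandated namespace `Summit.<Summit>.<Problem>` of this single-conjunct summit
set_option linter.overlappingInstances false -- the binders carry `[IsDomain O] [IsDiscreteValuationRing O]`

noncomputable section

open CategoryTheory CategoryTheory.Limits AlgebraicGeometry TopologicalSpace Topology IsLocalRing
open Literature.AlgebraicGeometry.Resolution
open Literature.AlgebraicGeometry.Morphisms (ProjCech.PP ProjCech.toSpec CechMH1)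
open Literature.AlgebraicGeometry.HodgeTheory (normalSheaf)
open AlgebraicGeometry.Scheme.IdealSheafData

namespace Summit.ResolutionOfSingularities.ResolutionOfSingularities.Cruxes.EquisingularLiftNat.Sections

set_option maxHeartbeats 1600000 in -- long binder texts
/-- **(N1°) from T-DIRLIFT-UP** (see the module docstring for the currency of the named input `hUP`). [cite: GortzWedhorn2020, Prop. 4.20 and (13.19)]
[cite: StacksProject, Tags 0804, 0805, 01WS] [OURS · L1 W4.5b · S6 (a)–(c)] toward `stub_elnat_coneTowerPointResolution` (stmt-ResolutionOfSingularities-20148 /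
-20038); NOT a statement of the manuscript. -/
theorem Tower.hRootCentre_of_dirLiftUp (O : Type) [CommRing O] [IsDomain O] [IsDiscreteValuationRing O] (k : Type) [Field k]
    (θ : O →+* k) (hθ : Function.Surjective θ) (P : Scheme.{0}) (q : P ⟶ Spec (.of O)) (Y : Set P)
    -- ======== THE NAMED INPUT: T-DIRLIFT-UP, tower currency (v3) ========
    (hUP : ∀ (X₀ G₀ : Scheme.{0}) (f₀ : X₀ ⟶ Spec (.of O)) (j₀ : G₀ ⟶ X₀) (t₀ : G₀ ⟶ Spec (.of k)),
        IsPullback j₀ t₀ f₀ (Spec.map (CommRingCat.ofHom θ)) → IsIntegral X₀ → IsLocallyNoetherian X₀ → Scheme.IsRegular X₀ →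
        ∀ (I : X₀.IdealSheafData), Scheme.IsRegular I.subscheme → Flat (I.subschemeι ≫ f₀) →
        (∀ x ∈ I.support, ∃ c : Fin 2 → X₀.presheaf.stalk x, Ideal.span (Set.range c) = stalkIdeal I x ∧ IsQuasiRegular c) →
        ∀ (e₁ : I.subscheme ≅ ProjCech.PP O 1), e₁.hom ≫ ProjCech.toSpec O 1 = I.subschemeι ≫ f₀ →
        ∀ (Z₀ : Set G₀) (hZ₀ : IsClosed Z₀), I.comap j₀ = vanishingIdeal ⟨Z₀, hZ₀⟩ →
        ∀ (G₁ : Scheme.{0}) (υ : G₁ ⟶ G₀), IsBlowup υ (vanishingIdeal ⟨Z₀, hZ₀⟩) → UniversallyClosed υ →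
        -- the exceptional pair, abstract: `Γ̃ ↪ Ẽ ↪ G₁`, reduced, `Ẽ` supported on `υ⁻¹Z₀`
        ∀ (Et Gt : Scheme.{0}) (ιE : Et ⟶ G₁) (ιΓ : Gt ⟶ Et), IsClosedImmersion ιE → IsClosedImmersion ιΓ →
        IsReduced Et → IsReduced Gt → Set.range ιE = υ ⁻¹' Z₀ → IsIrreducible (Set.range (ιΓ ≫ ιE)) →
        (∃ δ : Gt ⟶ (vanishingIdeal (⟨Z₀, hZ₀⟩ : Closeds G₀)).subscheme,
          δ ≫ (vanishingIdeal (⟨Z₀, hZ₀⟩ : Closeds G₀)).subschemeι = (ιΓ ≫ ιE) ≫ υ ∧ IsIso δ) →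
        (∀ x : Gt, IsRegularLocalRing (Et.presheaf.stalk (ιΓ x))) →
        (∃ V : Fin 2 → Gt.Opens, (∀ j, IsAffineOpen (V j)) ∧ IsAffineOpen (V 0 ⊓ V 1) ∧ ⨆ j, V j = ⊤ ∧
          Subsingleton (CechMH1 Gt.toSpecΓ (normalSheaf ιΓ) V)) →
        -- the downstairs direction of the section (DIRDICT (a) output)
        ∀ (𝒟' : G₀.IdealSheafData),
        vanishingIdeal (⟨Z₀, hZ₀⟩ : Closeds G₀) * vanishingIdeal ⟨Z₀, hZ₀⟩ ≤ 𝒟' → 𝒟' ≤ vanishingIdeal ⟨Z₀, hZ₀⟩ →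
        (∀ z ∈ Z₀, ∃ c : Fin 2 → G₀.presheaf.stalk z, Ideal.span (Set.range c) = stalkIdeal (vanishingIdeal (⟨Z₀, hZ₀⟩ : Closeds G₀)) z ∧
          IsQuasiRegular c ∧ stalkIdeal 𝒟' z = Ideal.span {c 0} ⊔ Ideal.span {c 1 * c 1}) →
        (∀ hΓc : IsClosed (Set.range (ιΓ ≫ ιE)),
          controlledTransform υ (vanishingIdeal ⟨Z₀, hZ₀⟩) 𝒟' 1 = vanishingIdeal ⟨Set.range (ιΓ ≫ ιE), hΓc⟩) →
        ∃ 𝒟 : X₀.IdealSheafData, I * I ≤ 𝒟 ∧ 𝒟 ≤ I ∧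
          (∀ x ∈ I.support, ∃ c : Fin 2 → X₀.presheaf.stalk x, Ideal.span (Set.range c) = stalkIdeal I x ∧ IsQuasiRegular c ∧
            stalkIdeal 𝒟 x = Ideal.span {c 0} ⊔ Ideal.span {c 1 * c 1}) ∧
          𝒟.comap j₀ = 𝒟') :
    -- ======== the (N1°) text of `Tower.hCentre_of_root` (p570977), verbatim ========
    ∀ {F₉ : Scheme.{0}} (Z₉ : Set F₉) (hZ₉ : IsClosed Z₉) {F₁₀ : Scheme.{0}} (υ' : F₁₀ ⟶ F₉)
        (G : Scheme.{0}) (γ : G ⟶ F₁₀) (E : Set G) (hE : IsClosed E) (Z : Set G) (hZ : IsClosed Z),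
        DirStepSec F₉ F₁₀ υ' Z₉ hZ₉ G γ Z hZ → RationalCarrier (redSub F₉ Z₉ hZ₉) →
        (∀ x : redSub G Z hZ, IsRegularLocalRing (G.presheaf.stalk (redSubι G Z hZ x))) →
        (∀ (i : redSub G Z hZ ⟶ redSub G E hE), i ≫ redSubι G E hE = redSubι G Z hZ →
          ∀ x : redSub G Z hZ, IsRegularLocalRing ((redSub G E hE).presheaf.stalk (i x))) →
        DirStepUnobs G E hE Z hZ → Z ⊆ E →
        ∀ (X : Scheme.{0}) (σ : X ⟶ P) (jG : G ⟶ X) (tG : G ⟶ Spec (.of k)) (𝓔 : X.IdealSheafData),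
        IsIntegral X → IsLocallyNoetherian X → Scheme.IsRegular X →
        IsPullback jG tG (σ ≫ q) (Spec.map (CommRingCat.ofHom θ)) →
        𝓔.comap jG = vanishingIdeal ⟨E, hE⟩ → (∀ z : X, (stalkIdeal 𝓔 z).IsPrincipal) → Scheme.IsRegular 𝓔.subscheme →
        ∀ (X₀ : Scheme.{0}) (σ₀ : X₀ ⟶ P) (I : X₀.IdealSheafData) (X₁ : Scheme.{0}) (τ₀ : X₁ ⟶ X₀) (ρ : X ⟶ X₁)
          (G₀ : Scheme.{0}) (j₀ : G₀ ⟶ X₀) (t₀ : G₀ ⟶ Spec (.of k)) (γ₀ : G₀ ⟶ F₉)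
          (G₁ : Scheme.{0}) (j₁ : G₁ ⟶ X₁) (t₁ : G₁ ⟶ Spec (.of k)) (υ₁ : G₁ ⟶ G₀) (ϱ : G ⟶ G₁)
          (e : 𝓔.subscheme ≅ (I.comap τ₀).subscheme) (Z₀ : Set G₀) (hZ₀ : IsClosed Z₀) (δ₀ : redSub G₀ Z₀ hZ₀ ⟶ redSub F₉ Z₉ hZ₉),
        IsIntegral X₀ → IsLocallyNoetherian X₀ → Scheme.IsRegular X₀ → IsBlowup τ₀ I → σ = (ρ ≫ τ₀) ≫ σ₀ →
        e.hom ≫ (I.comap τ₀).subschemeι = 𝓔.subschemeι ≫ ρ →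
        IsPullback j₀ t₀ (σ₀ ≫ q) (Spec.map (CommRingCat.ofHom θ)) → IsPullback j₁ t₁ ((τ₀ ≫ σ₀) ≫ q) (Spec.map (CommRingCat.ofHom θ)) →
        j₁ ≫ τ₀ = υ₁ ≫ j₀ → IsBlowup υ₁ (I.comap j₀) → jG ≫ ρ = ϱ ≫ j₁ → ϱ ≫ υ₁ ≫ γ₀ = γ ≫ υ' →
        I.comap j₀ = vanishingIdeal ⟨Z₀, hZ₀⟩ → δ₀ ≫ redSubι F₉ Z₉ hZ₉ = redSubι G₀ Z₀ hZ₀ ≫ γ₀ → IsIso δ₀ →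
        Scheme.IsRegular I.subscheme → Flat (I.subschemeι ≫ σ₀ ≫ q) → σ₀ '' (I.support : Set X₀) ⊆ {p : P | ¬ IsGenericPoint p Y} →
        (∀ x ∈ I.support, ∃ c : Fin 2 → X₀.presheaf.stalk x, Ideal.span (Set.range c) = stalkIdeal I x ∧ IsQuasiRegular c) →
        (RationalCarrier (redSub F₉ Z₉ hZ₉) → ∃ e₁ : I.subscheme ≅ ProjCech.PP O 1, e₁.hom ≫ ProjCech.toSpec O 1 = I.subschemeι ≫ σ₀ ≫ q) →
        ∃ (C₁ : X₁.IdealSheafData) (Γ₁ : Set G₁) (hΓ₁ : IsClosed Γ₁),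
          I.comap τ₀ ≤ C₁ ∧ Scheme.IsRegular C₁.subscheme ∧ Flat (C₁.subschemeι ≫ (τ₀ ≫ σ₀) ≫ q) ∧
          IsEffectiveCartier (C₁.comap (I.comap τ₀).subschemeι) ∧
          C₁.comap j₁ = vanishingIdeal ⟨Γ₁, hΓ₁⟩ ∧ E ∩ ϱ ⁻¹' Γ₁ = Z ∧
          (RationalCarrier (redSub F₉ Z₉ hZ₉) →
            ∃ e₁ : C₁.subscheme ≅ ProjCech.PP O 1, e₁.hom ≫ ProjCech.toSpec O 1 = C₁.subschemeι ≫ (τ₀ ≫ σ₀) ≫ q) := by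
  intro F₉ Z₉ hZ₉ F₁₀ υ' G γ E hE Z hZ hsec hrat _hGreg hEreg hunobs hZE X σ jG tG 𝓔 hXint hXnoeth _hXreg hsq he_i _he_ii _he_iii
    X₀ σ₀ I X₁ τ₀ ρ G₀ j₀ t₀ γ₀ G₁ j₁ t₁ υ₁ ϱ e Z₀ hZ₀ δ₀ hX₀int hX₀noeth hX₀reg hτ₀ hσ he hsq₀ hsq₁ hcomm₁ hυ₁ hcommG hϱ hĪ hδ₀ hδ₀iso
    hIreg hIflat _hIoff hfr hR4
  classical
  haveI := hXint
  haveI := hXnoeth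
  haveI := hX₀int
  haveI := hX₀noeth
  haveI := hδ₀iso
  haveI : IsLocallyNoetherian X₁ := hτ₀.isLocallyNoetherian
  haveI : IsClosedImmersion (Spec.map (CommRingCat.ofHom θ)) := IsClosedImmersion.spec_of_surjective _ hθ
  haveI : IsClosedImmersion j₀ := MorphismProperty.IsStableUnderBaseChange.of_isPullback hsq₀.flip inferInstance
  haveI : IsLocallyNoetherian G₀ := LocallyOfFiniteType.isLocallyNoetherian j₀
  -- R4: the rational carrier `V(I) ≅ ℙ¹_O`
  obtain ⟨e₁, he₁⟩ := hR4 hrat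
  -- the cartesian square of special fibres `(jG, ϱ, ρ, j₁)`
  have hsq' : IsPullback jG tG (ρ ≫ (τ₀ ≫ σ₀) ≫ q) (Spec.map (CommRingCat.ofHom θ)) := by
    have h : σ ≫ q = ρ ≫ (τ₀ ≫ σ₀) ≫ q := by rw [hσ]; simp only [Category.assoc]
    rw [← h]; exact hsq
  have hcart : IsPullback jG ϱ ρ j₁ := isPullback_of_model_squares θ hθ ((τ₀ ≫ σ₀) ≫ q) ρ j₁ t₁ hsq₁ jG tG hsq' ϱ hcommG
  -- the root's exceptional surface `E₁ = υ₁⁻¹Z₀`, its reduced trace, and the bridge `ε : Ẽ ≅ Ẽ₁`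
  have hE₁ : IsClosed (υ₁ ⁻¹' Z₀) := hZ₀.preimage υ₁.continuous
  have hsupp : (((I.comap τ₀).comap j₁).support : Set G₁) = υ₁ ⁻¹' Z₀ :=
    coe_support_comap_comap_eq_preimage τ₀ j₀ j₁ υ₁ hcomm₁ I hZ₀ hĪ
  obtain ⟨-, ε, hε, hεiso⟩ :=
    comap_eq_vanishingIdeal_and_exists_isIso_redSub_of_iso_over ρ jG j₁ ϱ hcart 𝓔 (I.comap τ₀) e he hE he_i hE₁ hsupp
  haveI := hεiso
  -- the inclusion `Z̃ ⟶ Ẽ` over `G`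
  obtain ⟨i, hi, hici⟩ := exists_redSub_hom_of_subset hZ hE hZE
  haveI := hici
  haveI : IsReduced (redSub G Z hZ) := ComponentGluing.isReduced_subscheme_vanishingIdeal _
  haveI : IsReduced (redSub G E hE) := ComponentGluing.isReduced_subscheme_vanishingIdeal _
  -- the composite closed immersion `Z̃ ⟶ G₁` and its range `ϱ(Z)`
  have hf : i ≫ ε ≫ redSubι G₁ (υ₁ ⁻¹' Z₀) hE₁ = redSubι G Z hZ ≫ ϱ := by rw [hε, ← Category.assoc, hi]
  have hrangeΓ : Set.range (i ≫ ε ≫ redSubι G₁ (υ₁ ⁻¹' Z₀) hE₁) = ϱ '' Z := by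
    rw [hf, Scheme.Hom.comp_base, TopCat.coe_comp, Set.range_comp, Scheme.IdealSheafData.range_subschemeι,
      Scheme.IdealSheafData.coe_support_vanishingIdeal]
    rfl
  obtain ⟨hc, -⟩ := exists_isIso_redSub_image ϱ hE hE₁ ε hε hZ hZE
  have hεsurj : Function.Surjective ε := ε.surjective
  have hrangeE : Set.range (ε ≫ redSubι G₁ (υ₁ ⁻¹' Z₀) hE₁) = υ₁ ⁻¹' Z₀ := by
    rw [Scheme.Hom.comp_base, TopCat.coe_comp, Set.range_comp, hεsurj.range_eq, Set.image_univ,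
      Scheme.IdealSheafData.range_subschemeι, Scheme.IdealSheafData.coe_support_vanishingIdeal]
    rfl
  -- the downstairs blow-up `υ₁` of `𝓘⟨Z₀⟩` is proper
  have hυ₁' : IsBlowup υ₁ (vanishingIdeal ⟨Z₀, hZ₀⟩) := hĪ ▸ hυ₁
  haveI : IsProper υ₁ := hυ₁'.isProper
  -- DIRDICT (a) at the root: its inputs (frames downstairs, the section over `ϱ(Z)`) and its output `𝒟'`
  have hfr₀ := forall_exists_twoFrame_specialFibre_of_flat O k θ hθ (σ₀ ≫ q) j₀ t₀ hsq₀ I hIflat hfr hZ₀ hĪ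
  have hΓZ : ϱ '' Z ⊆ υ₁ ⁻¹' Z₀ := fun y hy =>
    image_subset_of_redSub_hom_over ϱ hE hE₁ ε hε (Set.image_mono hZE hy)
  obtain ⟨δ₁, hδ₁, hδ₁iso⟩ := exists_dirStepSec_root_image υ' Z₉ hZ₉ γ hZ hsec γ₀ hZ₀ ⟨δ₀, hδ₀, hδ₀iso⟩ υ₁ ϱ hϱ hE hZE hE₁
    subset_rfl ε hε hc
  obtain ⟨𝒟', hII', h𝒟'I, hdir', hctr'⟩ :=
    exists_direction_of_section Z₀ hZ₀ hυ₁' hfr₀ (ϱ '' Z) hc hΓZ ⟨δ₁, hδ₁, hδ₁iso⟩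
  -- the section at the root, over `ϱ ≫ υ₁`, for the abstract pair
  obtain ⟨δ', hδ', hδ'iso⟩ := exists_dirStepSec_root υ' Z₉ hZ₉ γ hZ hsec γ₀ hZ₀ ⟨δ₀, hδ₀, hδ₀iso⟩ (ϱ ≫ υ₁)
    (by rw [Category.assoc, hϱ]) (fun z hz => hΓZ ⟨z, hz, rfl⟩)
  -- irreducibility of `Z` (a curve isomorphic to the rational carrier)
  have hZirr : IsIrreducible (Set.range (i ≫ ε ≫ redSubι G₁ (υ₁ ⁻¹' Z₀) hE₁)) := by
    obtain ⟨δ, -, hδiso⟩ := hsec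
    haveI := hδiso
    obtain ⟨k', _, ⟨eP⟩⟩ := hrat
    haveI : IrreducibleSpace ↥(Literature.AlgebraicGeometry.Motives.projectiveSpace 1 k').left :=
      Literature.AlgebraicGeometry.Motives.irreducibleSpace_projectiveSpace
    have huniv : IsIrreducible (Set.univ : Set ↥(redSub G Z hZ)) := by
      have h1 := (IrreducibleSpace.isIrreducible_univ ↥(Literature.AlgebraicGeometry.Motives.projectiveSpace 1 k').left).image _
        (Scheme.homeoOfIso (asIso δ ≪≫ eP)).symm.continuous.continuousOn
      rwa [Set.image_univ, (Scheme.homeoOfIso (asIso δ ≪≫ eP)).symm.surjective.range_eq] at h1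
    rw [← Set.image_univ]
    exact huniv.image _ (Scheme.Hom.continuous _).continuousOn
  -- ======== T-DIRLIFT-UP ========
  obtain ⟨𝒟, hII, h𝒟I, hdir, h𝒟comap⟩ := hUP X₀ G₀ (σ₀ ≫ q) j₀ t₀ hsq₀ hX₀int hX₀noeth hX₀reg I hIreg hIflat hfr e₁ he₁ Z₀ hZ₀ hĪ
    G₁ υ₁ hυ₁' inferInstance (redSub G E hE) (redSub G Z hZ) (ε ≫ redSubι G₁ (υ₁ ⁻¹' Z₀) hE₁) i inferInstance hici
    inferInstance inferInstance hrangeE hZirr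
    ⟨δ', by rw [hδ', hf, Category.assoc], hδ'iso⟩ (hEreg i hi) (hunobs i hi) 𝒟' hII' h𝒟'I hdir'
    (fun hΓc => by rw [hctr']; congr 1; ext1; exact hrangeΓ.symm)
  -- ======== the centre `C₁ := controlledTransform τ₀ I 𝒟 1`, `Γ₁ := ϱ(Z)` ========
  -- D3b: `V(C₁) ≅ V(I)` over `τ₀`
  obtain ⟨e₃, he₃⟩ := exists_subschemeIso_directionCentre_of_isLocallyNoetherian hτ₀ 𝒟 hII hdir
  refine ⟨controlledTransform τ₀ I 𝒟 1, ϱ '' Z, hc, comap_le_directionCentre τ₀ I 𝒟 hII, ?_, ?_, ?_, ?_, ?_, ?_⟩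
  · -- regular, along `e₃`
    intro a
    haveI := hIreg (e₃.hom a)
    exact IsRegularLocalRing.of_ringEquiv (asIso (e₃.hom.stalkMap a)).commRingCatIsoToRingEquiv
  · -- flat over `O`, along `e₃`
    have h : (controlledTransform τ₀ I 𝒟 1).subschemeι ≫ (τ₀ ≫ σ₀) ≫ q = e₃.hom ≫ (I.subschemeι ≫ σ₀ ≫ q) := by
      rw [← Category.assoc e₃.hom, he₃]; simp only [Category.assoc]
    rw [h]
    haveI := hIflat
    infer_instance
  · -- D5: Cartier on the exceptional divisor
    exact isEffectiveCartier_directionCentre_comap_exceptional hτ₀ 𝒟 hdir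
  · -- D4 + DIRDICT (a): the special-fibre trace is `𝓘⟨ϱ(Z)⟩`
    have hdirj : ∀ z ∈ (I.comap j₀).support, ∃ c : Fin 2 → X₀.presheaf.stalk (j₀ z),
        Ideal.span (Set.range c) = stalkIdeal I (j₀ z) ∧ stalkIdeal 𝒟 (j₀ z) = Ideal.span {c 0} ⊔ Ideal.span {c 1 * c 1} := by
      intro z hz
      have hx : j₀ z ∈ I.support := by
        have h : z ∈ ((I.comap j₀).support : Set G₀) := hz
        rw [Scheme.IdealSheafData.support_comap] at h
        exact h
      obtain ⟨c, hc', -, h𝒟⟩ := hdir _ hx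
      exact ⟨c, hc', h𝒟⟩
    rw [comap_directionCentre_eq_of_model hτ₀ 𝒟 hII hcomm₁ hυ₁ hdirj, h𝒟comap, hĪ, hctr']
  · -- the section pushed to the root: `E ∩ ϱ⁻¹(ϱ(Z)) = Z`
    exact inter_preimage_image_eq_of_redSub_iso_over ϱ hE hE₁ ε hε hZE
  · -- rational: `V(C₁) ≅ V(I) ≅ ℙ¹_O` over `q`
    intro _
    refine ⟨e₃ ≪≫ e₁, ?_⟩
    rw [Iso.trans_hom, Category.assoc, he₁, ← Category.assoc, he₃]
    simp only [Category.assoc]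

end Summit.ResolutionOfSingularities.ResolutionOfSingularities.Cruxes.EquisingularLiftNat.Sections

end
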